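import Summits.FinalStateConjecture.FinalStateConjecture.Cruxes.KillingSpinorEndgame.Lines.birth

/-!
# Proposed restatement of the crux `KillingSpinorEndgame` (stmt-FinalStateConjecture-17645) and the
# re-lined skeleton — for the PLANNER (lead prover's verdict `misstated`, 2026-08-17; dossier MISSTATED.md)

Two typed defects of the crux text, and the two stub-level repairs found by the line's wave 1, as
elaborating Lean (scratch; nothing here is proposed to the tree — statement items are the planner's):

1. **Intrinsic lateness in clause (i)** (finding F1, kernel-checked in
   `Theorems/KerrnessPropagatesKillingSpinorEndgameLatenessIdle.lean`, p152635): the lab time `τ` of the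
   crux's slab is a free label (`Φ`, `U` are chosen after `τ`; for `N ≤ 1` / comoving configurations
   `∀ τ₁ ∃ τ ≥ τ₁, slab` ↔ `∃ one slab`). Below, `RecursLate` fixes the label to `0` and asks the leaf to
   avoid `J⁻(K)` for EVERY compact `K` — the idiom of `Theses.BartnikGapSettling.Capture`
   (`Disjoint S (J⁻ K)`); in a globally hyperbolic development this is genuine lateness.
2. **Orthochronous motions** (`Summit.FinalStateConjecture.IsOrthochronous (mo i).1`): with
   `Λ ∈ O(1,3) ∖ O⁺(1,3)` the reference `boostedKerrBilin Λ c M a` is the white-hole (outgoing)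
   Kerr–Schild form; the ℝP³-geon witness (MISSTATED.md §F5) satisfies the crux's clause (i) with one
   exact white-hole slab for every `k`, `ε`, and the registered stub 1 (same `mo` in its conclusion) is
   false there. The Statement's `IsFutureOriented` already demands orthochronous motions of the
   decomposition; the hand-over configuration should too (or stub 1 must be allowed to re-describe).
3. **Waypoint regularity 3** for the global gauge consumed by PACKAGING (w2: horizon-normalised `C²`
   hole charts need `C³` decay of the horizon graph; `GlobalGauge 𝒟 2` gives `C²` only).
4. **No η-family interface** (w1: far-field freezing — from `∀ η, GaugeAlong … η` alone no convergent
   gauge can be assembled; let DYNAMICS conclude `GlobalGauge` directly).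

`KillingSpinorEndgameLate` is the crux with (1)+(2); `Sig.stub_dynamics'`, `Sig.stub_packaging'` and
`killingSpinorEndgameLate_of` are the re-lined two-stub skeleton over it (composition proved).
-/

open Literature.Geometry.Lorentzian
open scoped Manifold ContDiff Topology ENNReal
open Filter Set TopologicalSpace

set_option linter.dupNamespace false

namespace Summit.FinalStateConjecture.FinalStateConjecture.Cruxes.KillingSpinorEndgame.Proposed

open Summit.FinalStateConjecture.FinalStateConjecture.Theses.KerrnessPropagates
open Summit.FinalStateConjecture.FinalStateConjecture.Cruxes.KillingSpinorEndgame.Birth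

noncomputable section

variable {X : Type} [TopologicalSpace X] [ChartedSpace E3 X] [IsManifold (𝓡 3) ∞ X]
  [ConnectedSpace X] {D : InitialDataSet (𝓡 3) X}

/-- **Late recurrence** (proposed clause (i)): for every `ε > 0` and EVERY COMPACT `K ⊆ M` there is an
`ε`-good achronal slab chart (the crux's nine slab clauses verbatim, lab label `0`) whose leaf is
DISJOINT FROM `J⁻(K)`; and every motion is orthochronous. -/
def RecursLate (𝒟 : VacuumCauchyDevelopment D) (k N : ℕ) (M a r₀ : Fin N → ℝ)
    (mo : Fin N → ↥lorentzGroup × E4) : Prop :=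
  (∀ i, Summit.FinalStateConjecture.IsOrthochronous (mo i).1) ∧
  ∀ ε : ℝ, 0 < ε → ∀ K : Set 𝒟.carrier, IsCompact K →
    ∃ (R : Fin N → ℝ) (U : Opens E4) (Φ : U → 𝒟.carrier), (∀ i, r₀ i + 1 ≤ R i) ∧
      ContMDiff 𝓘(ℝ, E4) (𝓡 4) ∞ Φ ∧ Topology.IsOpenEmbedding Φ ∧
      {x : E4 | x 0 = 0 ∧ ∀ j, r₀ j < Kerr.radius (a j) (poincareInv (mo j).1 (mo j).2 x)} ⊆
        (U : Set E4) ∧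
      range Φ ⊆ 𝒟.metric.causalFuture 𝒟.timeOrientation (range 𝒟.embed) ∧
      Disjoint (Φ '' {x : ↥U | (x : E4) 0 = 0}) (𝒟.metric.causalPast 𝒟.timeOrientation K) ∧
      𝒟.metric.IsAchronal 𝒟.timeOrientation (Φ '' {x : ↥U | (x : E4) 0 = 0}) ∧
      (∀ i, supCkENorm {x : E4 | x 0 = 0 ∧
          (∀ j, r₀ j < Kerr.radius (a j) (poincareInv (mo j).1 (mo j).2 x)) ∧
          Kerr.radius (a i) (poincareInv (mo i).1 (mo i).2 x) ≤ R i} k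
        (𝒟.toSpacetime.deviationExtend ⟨U, boostedKerrBilin (mo i).1 (mo i).2 (M i) (a i),
          fun x ↦ x 0, fun x ↦ Kerr.radius (a i) (poincareInv (mo i).1 (mo i).2 x)⟩ Φ) ≤
        ENNReal.ofReal ε) ∧
      supCkENorm {x : E4 | x 0 = 0 ∧
          (∀ j, r₀ j < Kerr.radius (a j) (poincareInv (mo j).1 (mo j).2 x)) ∧
          ∀ j, R j - 1 ≤ Kerr.radius (a j) (poincareInv (mo j).1 (mo j).2 x)} k
        (𝒟.toSpacetime.deviationExtend (Minkowski.backgroundOn U) Φ) ≤ ENNReal.ofReal ε ∧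
      (∀ x : ↥U, x.1 0 = 0 →
        (∀ j, R j - 1 ≤ Kerr.radius (a j) (poincareInv (mo j).1 (mo j).2 x.1)) →
        𝒟.timeOrientation.IsFutureDirected (mfderiv 𝓘(ℝ, E4) (𝓡 4) Φ x (E4.basisVector 0)))

/-- **The crux restated** (proposal): as `KillingSpinorEndgame`, with clause (i) replaced by
`RecursLate` (intrinsic lateness + orthochronous motions); hypothesis (ii) and the conclusion verbatim. -/
def KillingSpinorEndgameLate : Prop :=
  ∃ k : ℕ, ∀ (X : Type) [TopologicalSpace X] [ChartedSpace E3 X] [IsManifold (𝓡 3) ∞ X]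
    [T2Space X] [SecondCountableTopology X] [ConnectedSpace X] (D : InitialDataSet (𝓡 3) X),
    D ∈ admissibleVacuumData X → ∀ 𝒟 : VacuumCauchyDevelopment D, 𝒟.IsMaximal →
    Summit.FinalStateConjecture.HasCompleteNullInfinity 𝒟.toCauchyDevelopment →
    (∃ (N : ℕ) (M a r₀ : Fin N → ℝ) (mo : Fin N → ↥lorentzGroup × E4),
      (∀ i, Kerr.IsSubextremal (M i) (a i) ∧
        r₀ i ∈ Ioo (Kerr.rMinus (M i) (a i)) (Kerr.rPlus (M i) (a i))) ∧
      RecursLate 𝒟 k N M a r₀ mo) →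
    (∀ (O : Set 𝒟.carrier) (d : FinalStateDecomposition 𝒟.toSpacetime O 2),
      (∀ i, Kerr.IsSubextremal (d.mass i) (d.spin i)) →
      O = Summit.FinalStateConjecture.exteriorOf 𝒟.toCauchyDevelopment d.charted →
      Summit.FinalStateConjecture.HasExhaustiveCharts d →
      Summit.FinalStateConjecture.IsFutureOriented d →
      Summit.FinalStateConjecture.RaysStayInClosure 𝒟.toCauchyDevelopment O) →
    ∃ (O : Set 𝒟.carrier) (d : FinalStateDecomposition 𝒟.toSpacetime O 2),
      (∀ i, Kerr.IsSubextremal (d.mass i) (d.spin i)) ∧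
      O = Summit.FinalStateConjecture.exteriorOf 𝒟.toCauchyDevelopment d.charted ∧
      Summit.FinalStateConjecture.RaysStayInClosure 𝒟.toCauchyDevelopment O ∧
      Summit.FinalStateConjecture.HasExhaustiveCharts d ∧
      Summit.FinalStateConjecture.IsFutureOriented d

/-- **Re-lined stub 1 — DYNAMICS'** (open problem, the whole difficulty): late recurrence at a
prover-chosen regularity `k` (take `k ≥ 4`, MISSTATED.md §F4) ⇒ capture in ONE convergent global gauge of
regularity 3 to SOME sub-extremal, orthochronous, horizon-penetrating configuration (re-description
allowed; consolidation folded in — no η-family interface). -/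
def Sig.stub_dynamics' : Prop :=
  ∃ k : ℕ,
  ∀ (X : Type) [TopologicalSpace X] [ChartedSpace E3 X] [IsManifold (𝓡 3) ∞ X]
    [T2Space X] [SecondCountableTopology X] [ConnectedSpace X] (D : InitialDataSet (𝓡 3) X),
    D ∈ admissibleVacuumData X → ∀ 𝒟 : VacuumCauchyDevelopment D, 𝒟.IsMaximal →
    Summit.FinalStateConjecture.HasCompleteNullInfinity 𝒟.toCauchyDevelopment →
    ∀ (N : ℕ) (M a r₀ : Fin N → ℝ) (mo : Fin N → ↥lorentzGroup × E4),
    (∀ i, Kerr.IsSubextremal (M i) (a i) ∧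
      r₀ i ∈ Ioo (Kerr.rMinus (M i) (a i)) (Kerr.rPlus (M i) (a i))) →
    RecursLate 𝒟 k N M a r₀ mo →
    ∃ (N' : ℕ) (M' a' r₀' : Fin N' → ℝ) (mo' : Fin N' → ↥lorentzGroup × E4),
      (∀ i, Kerr.IsSubextremal (M' i) (a' i) ∧
        r₀' i ∈ Ioo (Kerr.rMinus (M' i) (a' i)) (Kerr.rPlus (M' i) (a' i)) ∧
        Summit.FinalStateConjecture.IsOrthochronous (mo' i).1) ∧
      GlobalGauge 𝒟 3 N' M' a' r₀' mo'

/-- **Re-lined stub 2 — PACKAGING'** (XL causal bookkeeping + late-time horizon as a `C³` graph): a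
convergent global gauge of regularity 3 to a sub-extremal, orthochronous, horizon-penetrating
configuration packages into an honest exterior decomposition. -/
def Sig.stub_packaging' : Prop :=
  ∀ (X : Type) [TopologicalSpace X] [ChartedSpace E3 X] [IsManifold (𝓡 3) ∞ X]
    [T2Space X] [SecondCountableTopology X] [ConnectedSpace X] (D : InitialDataSet (𝓡 3) X),
    D ∈ admissibleVacuumData X → ∀ 𝒟 : VacuumCauchyDevelopment D, 𝒟.IsMaximal →
    Summit.FinalStateConjecture.HasCompleteNullInfinity 𝒟.toCauchyDevelopment →
    ∀ (N : ℕ) (M a r₀ : Fin N → ℝ) (mo : Fin N → ↥lorentzGroup × E4),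
    (∀ i, Kerr.IsSubextremal (M i) (a i) ∧
      r₀ i ∈ Ioo (Kerr.rMinus (M i) (a i)) (Kerr.rPlus (M i) (a i)) ∧
      Summit.FinalStateConjecture.IsOrthochronous (mo i).1) →
    GlobalGauge 𝒟 3 N M a r₀ mo → HonestExterior 𝒟

/-- **The re-lined skeleton closes the restated crux** (pure logic). -/
theorem killingSpinorEndgameLate_of :
    Sig.stub_dynamics' → Sig.stub_packaging' → KillingSpinorEndgameLate := by
  intro hdyn hpack
  obtain ⟨k, hk⟩ := hdyn
  refine ⟨k, ?_⟩
  intro X _ _ _ _ _ _ D hD 𝒟 hmax hscri hrec hint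
  obtain ⟨N, M, a, r₀, mo, hsub, hrec⟩ := hrec
  obtain ⟨N', M', a', r₀', mo', hsub', hgg⟩ := hk X D hD 𝒟 hmax hscri N M a r₀ mo hsub hrec
  obtain ⟨O, d, hdsub, hO, hexh, hfo⟩ := hpack X D hD 𝒟 hmax hscri N' M' a' r₀' mo' hsub' hgg
  exact ⟨O, d, hdsub, hO, hint O d hdsub hO hexh hfo, hexh, hfo⟩

end

end Summit.FinalStateConjecture.FinalStateConjecture.Cruxes.KillingSpinorEndgame.Proposed
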